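import Summits.AtomisticToContinuum.Crystallization.Theorems.FrustratedLawDichotomyStrainedPatchHomValueT2SlopeSoundF

/-!
# (I1) slope part H — the Lipschitz-class second-order model READ THROUGH THE GRAPH and the POINT Jacobian membership (`…HomValueT2Track` §14b, the
# entries `jc` (summed point `jF`) and `rp`; critic row 1674 (B) (I1) docket item 3 `slopeT2_sound`, eighth instalment; 27623 `(H) HomFloor`; decomp-a2c hand-1 g49)

`forceB_taylor2_graph`: part F's second-order enclosure with its first-order term rewritten through the track graph, `Σ_{k<9} dF^ℝ_k(x_c) δ_k =
Σ_{e<6} jF^ℝ_e(x_c) δ_e` (`…SoundZ.lin_graph`); `mem_jF_cen`: the POINT record encloses `jF^ℝ_e(x_c)` (`jF aP Rp a e ∋ ·`, centre off the junction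
radii).  No definitions; 0 sorry; standard axioms.  `--supports stmt-AtomisticToContinuum-27623`.
-/

noncomputable section

namespace Summit.AtomisticToContinuum.Crystallization.Theorems.FrustratedLawDichotomyStrainedPatchHomValueT2Kit

open scoped BigOperators RealInnerProductSpace
open Finset
open Literature.Analysis.ValidatedNumerics.Numerics
open Summit.AtomisticToContinuum.Crystallization.Theorems.ChargedEnergyGapNegative (E3)
open Summit.AtomisticToContinuum.Crystallization.Theorems.FrustratedLawDichotomySchurCut (effPot w₄₅ ω₄)
open Summit.AtomisticToContinuum.Crystallization.Theorems.FrustratedLawDichotomyStrainedPatchTaylorLeaves (junctions)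
open Summit.AtomisticToContinuum.Crystallization.Theorems.FrustratedLawDichotomyStrainedPatchHomEntryGramHcp (dot3 mem_dot3 shufFI)
open Summit.AtomisticToContinuum.Crystallization.Theorems.FrustratedLawDichotomyStrainedPatchHomSplit (latPt hexFrame hcpShift)
open Summit.AtomisticToContinuum.Crystallization.Theorems.FrustratedLawDichotomyStrainedPatchHomCurvCentreKit (boxE cenE cenX cenMap cenShuf)

/-- ★★ **`B`-FAMILY SECOND-ORDER FORCE ENCLOSURE THROUGH THE GRAPH** (Lipschitz class): `|β y_a(1) − β y_a(0) − Σ_{e<6} jF^ℝ_e(x_c) δ_e| ≤ ½ ΣΣ |ddF|↑/SC |δ||δ|`.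
[folklore chaining: part F + `lin_graph`] -/
theorem forceB_taylor2_graph {c w : (Fin 3 × Fin 3) ⊕ Fin 3 → ℤ} (U : E3 →L[ℝ] E3) (ξ : E3) (hsa : ∀ v v' : E3, ⟪U v, v'⟫ = ⟪v, U v'⟫)
    (hc : ∀ a b : Fin 3, c (Sum.inl (a, b)) = c (Sum.inl (b, a)))
    (hbox : ∀ ab : Fin 3 × Fin 3, |(U (EuclideanSpace.single ab.2 (1 : ℝ))) ab.1 - (c (Sum.inl ab) : ℝ) / SC| ≤ (w (Sum.inl ab) : ℝ) / SC)
    (hξ : ∀ i : Fin 3, |ξ i - (c (Sum.inr i) : ℝ) / SC| ≤ (w (Sum.inr i) : ℝ) / SC)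
    (A : ℕ → ℕ → ℝ) (hgraph : ∀ m, m < 3 → dispN (U - cenMap c) (ξ - cenShuf c) (6 + m) = ∑ e ∈ range 6, A m e * dispN (U - cenMap c) (ξ - cenShuf c) e)
    {b : Fin 3 → ℤ} {Rb : DRec} (hRb : mkDRec 9 (boxE c w) (qB (shufFI c w) b) = some Rb)
    (hJ : ‖latPt (cenMap c) hexFrame b + cenMap c (hcpShift + cenShuf c)‖ ∉ junctions) (hlip : Rb.co.lip = true) (a : Fin 3) :
    |deriv (effPot w₄₅ ω₄ (3 / 400)) ‖latPt U hexFrame b + U (hcpShift + ξ)‖ / ‖latPt U hexFrame b + U (hcpShift + ξ)‖ * (latPt U hexFrame b + U (hcpShift + ξ)) a - deriv (effPot w₄₅ ω₄ (3 / 400)) ‖cenMap c (latPt (1 : E3 →L[ℝ] E3) hexFrame b + (hcpShift + cenShuf c))‖ / ‖cenMap c (latPt (1 : E3 →L[ℝ] E3) hexFrame b + (hcpShift + cenShuf c))‖ * (cenMap c (latPt (1 : E3 →L[ℝ] E3) hexFrame b + (hcpShift + cenShuf c))) a -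
        ∑ e ∈ range 6, (((deriv (deriv (effPot w₄₅ ω₄ (3 / 400))) ‖cenMap c (latPt (1 : E3 →L[ℝ] E3) hexFrame b + (hcpShift + cenShuf c))‖ - deriv (effPot w₄₅ ω₄ (3 / 400)) ‖cenMap c (latPt (1 : E3 →L[ℝ] E3) hexFrame b + (hcpShift + cenShuf c))‖ / ‖cenMap c (latPt (1 : E3 →L[ℝ] E3) hexFrame b + (hcpShift + cenShuf c))‖) / ‖cenMap c (latPt (1 : E3 →L[ℝ] E3) hexFrame b + (hcpShift + cenShuf c))‖ ^ 2 * (zetaN (cenMap c) (latPt (1 : E3 →L[ℝ] E3) hexFrame b + (hcpShift + cenShuf c)) e * (cenMap c (latPt (1 : E3 →L[ℝ] E3) hexFrame b + (hcpShift + cenShuf c))) a) + deriv (effPot w₄₅ ω₄ (3 / 400)) ‖cenMap c (latPt (1 : E3 →L[ℝ] E3) hexFrame b + (hcpShift + cenShuf c))‖ / ‖cenMap c (latPt (1 : E3 →L[ℝ] E3) hexFrame b + (hcpShift + cenShuf c))‖ * dyR (cenMap c) (latPt (1 : E3 →L[ℝ] E3) hexFrame b + (hcpShift + cenShuf c)) e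 a) + (A 0 e * ((deriv (deriv (effPot w₄₅ ω₄ (3 / 400))) ‖cenMap c (latPt (1 : E3 →L[ℝ] E3) hexFrame b + (hcpShift + cenShuf c))‖ - deriv (effPot w₄₅ ω₄ (3 / 400)) ‖cenMap c (latPt (1 : E3 →L[ℝ] E3) hexFrame b + (hcpShift + cenShuf c))‖ / ‖cenMap c (latPt (1 : E3 →L[ℝ] E3) hexFrame b + (hcpShift + cenShuf c))‖) / ‖cenMap c (latPt (1 : E3 →L[ℝ] E3) hexFrame b + (hcpShift + cenShuf c))‖ ^ 2 * (zetaN (cenMap c) (latPt (1 : E3 →L[ℝ] E3) hexFrame b + (hcpShift + cenShuf c)) 6 * (cenMap c (latPt (1 : E3 →L[ℝ] E3) hexFrame b + (hcpShift + cenShuf c))) a) + deriv (effPot w₄₅ ω₄ (3 / 400)) ‖cenMap c (latPt (1 : E3 →L[ℝ] E3) hexFrame b + (hcpShift + cenShuf c))‖ / ‖cenMap c (latPt (1 : E3 →L[ℝ] E3) hexFrame b + (hcpShift + cenShuf c))‖ * dyR (cenMap c) (latPt (1 : E3 →L[ℝ] E3) hexFrame b + (hcpShift + cenShuf c)) 6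 a) + A 1 e * ((deriv (deriv (effPot w₄₅ ω₄ (3 / 400))) ‖cenMap c (latPt (1 : E3 →L[ℝ] E3) hexFrame b + (hcpShift + cenShuf c))‖ - deriv (effPot w₄₅ ω₄ (3 / 400)) ‖cenMap c (latPt (1 : E3 →L[ℝ] E3) hexFrame b + (hcpShift + cenShuf c))‖ / ‖cenMap c (latPt (1 : E3 →L[ℝ] E3) hexFrame b + (hcpShift + cenShuf c))‖) / ‖cenMap c (latPt (1 : E3 →L[ℝ] E3) hexFrame b + (hcpShift + cenShuf c))‖ ^ 2 * (zetaN (cenMap c) (latPt (1 : E3 →L[ℝ] E3) hexFrame b + (hcpShift + cenShuf c)) 7 * (cenMap c (latPt (1 : E3 →L[ℝ] E3) hexFrame b + (hcpShift + cenShuf c))) a) + deriv (effPot w₄₅ ω₄ (3 / 400)) ‖cenMap c (latPt (1 : E3 →L[ℝ] E3) hexFrame b + (hcpShift + cenShuf c))‖ / ‖cenMap c (latPt (1 : E3 →L[ℝ] E3) hexFrame b + (hcpShift + cenShuf c))‖ * dyR (cenMap c) (latPt (1 : E3 →L[ℝ] E3) hexFrame b + (hcpShift + cenShuf c)) 7 a)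 + A 2 e * ((deriv (deriv (effPot w₄₅ ω₄ (3 / 400))) ‖cenMap c (latPt (1 : E3 →L[ℝ] E3) hexFrame b + (hcpShift + cenShuf c))‖ - deriv (effPot w₄₅ ω₄ (3 / 400)) ‖cenMap c (latPt (1 : E3 →L[ℝ] E3) hexFrame b + (hcpShift + cenShuf c))‖ / ‖cenMap c (latPt (1 : E3 →L[ℝ] E3) hexFrame b + (hcpShift + cenShuf c))‖) / ‖cenMap c (latPt (1 : E3 →L[ℝ] E3) hexFrame b + (hcpShift + cenShuf c))‖ ^ 2 * (zetaN (cenMap c) (latPt (1 : E3 →L[ℝ] E3) hexFrame b + (hcpShift + cenShuf c)) 8 * (cenMap c (latPt (1 : E3 →L[ℝ] E3) hexFrame b + (hcpShift + cenShuf c))) a) + deriv (effPot w₄₅ ω₄ (3 / 400)) ‖cenMap c (latPt (1 : E3 →L[ℝ] E3) hexFrame b + (hcpShift + cenShuf c))‖ / ‖cenMap c (latPt (1 : E3 →L[ℝ] E3) hexFrame b + (hcpShift + cenShuf c))‖ * dyR (cenMap c) (latPt (1 : E3 →L[ℝ] E3) hexFrame b + (hcpShift + cenShuf c)) 8 a)))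 * dispN (U - cenMap c) (ξ - cenShuf c) e| ≤
      1 / 2 * ∑ k ∈ range 9, ∑ l ∈ range 9, (((ddF Rb a k l).absHi : ℤ) : ℝ) / SC * (|dispN (U - cenMap c) (ξ - cenShuf c) k| * |dispN (U - cenMap c) (ξ - cenShuf c) l|) := by
  have h := forceB_taylor2 U ξ hsa hc hbox hξ hRb hJ hlip a
  rw [lin_graph (fun k => ((deriv (deriv (effPot w₄₅ ω₄ (3 / 400))) ‖cenMap c (latPt (1 : E3 →L[ℝ] E3) hexFrame b + (hcpShift + cenShuf c))‖ - deriv (effPot w₄₅ ω₄ (3 / 400)) ‖cenMap c (latPt (1 : E3 →L[ℝ] E3) hexFrame b + (hcpShift + cenShuf c))‖ / ‖cenMap c (latPt (1 : E3 →L[ℝ] E3) hexFrame b + (hcpShift + cenShuf c))‖) / ‖cenMap c (latPt (1 : E3 →L[ℝ] E3) hexFrame b + (hcpShift + cenShuf c))‖ ^ 2 * (zetaN (cenMap c) (latPt (1 : E3 →L[ℝ] E3) hexFrame b + (hcpShift + cenShuf c)) k * (cenMap c (latPt (1 : E3 →L[ℝ] E3) hexFrame b + (hcpShift + cenShuf c)))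 a) + deriv (effPot w₄₅ ω₄ (3 / 400)) ‖cenMap c (latPt (1 : E3 →L[ℝ] E3) hexFrame b + (hcpShift + cenShuf c))‖ / ‖cenMap c (latPt (1 : E3 →L[ℝ] E3) hexFrame b + (hcpShift + cenShuf c))‖ * dyR (cenMap c) (latPt (1 : E3 →L[ℝ] E3) hexFrame b + (hcpShift + cenShuf c)) k a)) (dispN (U - cenMap c) (ξ - cenShuf c)) A hgraph] at h
  exact h

/-- ★ **THE POINT RECORD ENCLOSES THE GRAPH-COMBINED JACOBIAN AT THE CENTRE**: `jF aP Rp a e ∋ jF^ℝ_e(x_c)` (`e < 6`, centre radius off the junction radii,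
`A_me = aP m e/SC`). [folklore chaining: `mem_coefL` at the centre, `mem_dF`, `mem_jF`] -/
theorem mem_jF_cen (c : (Fin 3 × Fin 3) ⊕ Fin 3 → ℤ) (aP : Fin 3 → Fin 6 → ℤ) (A : ℕ → ℕ → ℝ)
    (hA : ∀ m e (hm : m < 3) (he : e < 6), A m e = ((aP ⟨m, hm⟩ ⟨e, he⟩ : ℤ) : ℝ) / SC)
    {b : Fin 3 → ℤ} {Rp : DRec} (hRp : mkDRec 9 (cenE c) (qB (cenX c) b) = some Rp)
    (hJ : ‖latPt (cenMap c) hexFrame b + cenMap c (hcpShift + cenShuf c)‖ ∉ junctions) (a : Fin 3) {e : ℕ} (he : e < 6) :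
    FI.mem (((deriv (deriv (effPot w₄₅ ω₄ (3 / 400))) ‖cenMap c (latPt (1 : E3 →L[ℝ] E3) hexFrame b + (hcpShift + cenShuf c))‖ - deriv (effPot w₄₅ ω₄ (3 / 400)) ‖cenMap c (latPt (1 : E3 →L[ℝ] E3) hexFrame b + (hcpShift + cenShuf c))‖ / ‖cenMap c (latPt (1 : E3 →L[ℝ] E3) hexFrame b + (hcpShift + cenShuf c))‖) / ‖cenMap c (latPt (1 : E3 →L[ℝ] E3) hexFrame b + (hcpShift + cenShuf c))‖ ^ 2 * (zetaN (cenMap c) (latPt (1 : E3 →L[ℝ] E3) hexFrame b + (hcpShift + cenShuf c)) e * (cenMap c (latPt (1 : E3 →L[ℝ] E3) hexFrame b + (hcpShift + cenShuf c))) a) + deriv (effPot w₄₅ ω₄ (3 / 400)) ‖cenMap c (latPt (1 : E3 →L[ℝ] E3) hexFrame b + (hcpShift + cenShuf c))‖ / ‖cenMap c (latPt (1 : E3 →L[ℝ] E3) hexFrame b + (hcpShift + cenShuf c))‖ * dyR (cenMap c) (latPt (1 : E3 →L[ℝ] E3) hexFrame b + (hcpShift + cenShuf c)) e a) + (A 0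 e * ((deriv (deriv (effPot w₄₅ ω₄ (3 / 400))) ‖cenMap c (latPt (1 : E3 →L[ℝ] E3) hexFrame b + (hcpShift + cenShuf c))‖ - deriv (effPot w₄₅ ω₄ (3 / 400)) ‖cenMap c (latPt (1 : E3 →L[ℝ] E3) hexFrame b + (hcpShift + cenShuf c))‖ / ‖cenMap c (latPt (1 : E3 →L[ℝ] E3) hexFrame b + (hcpShift + cenShuf c))‖) / ‖cenMap c (latPt (1 : E3 →L[ℝ] E3) hexFrame b + (hcpShift + cenShuf c))‖ ^ 2 * (zetaN (cenMap c) (latPt (1 : E3 →L[ℝ] E3) hexFrame b + (hcpShift + cenShuf c)) 6 * (cenMap c (latPt (1 : E3 →L[ℝ] E3) hexFrame b + (hcpShift + cenShuf c))) a) + deriv (effPot w₄₅ ω₄ (3 / 400)) ‖cenMap c (latPt (1 : E3 →L[ℝ] E3) hexFrame b + (hcpShift + cenShuf c))‖ / ‖cenMap c (latPt (1 : E3 →L[ℝ] E3) hexFrame b + (hcpShift + cenShuf c))‖ * dyR (cenMap c) (latPt (1 : E3 →L[ℝ] E3) hexFrame b + (hcpShift + cenShuf c)) 6 a) + A 1 e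 * ((deriv (deriv (effPot w₄₅ ω₄ (3 / 400))) ‖cenMap c (latPt (1 : E3 →L[ℝ] E3) hexFrame b + (hcpShift + cenShuf c))‖ - deriv (effPot w₄₅ ω₄ (3 / 400)) ‖cenMap c (latPt (1 : E3 →L[ℝ] E3) hexFrame b + (hcpShift + cenShuf c))‖ / ‖cenMap c (latPt (1 : E3 →L[ℝ] E3) hexFrame b + (hcpShift + cenShuf c))‖) / ‖cenMap c (latPt (1 : E3 →L[ℝ] E3) hexFrame b + (hcpShift + cenShuf c))‖ ^ 2 * (zetaN (cenMap c) (latPt (1 : E3 →L[ℝ] E3) hexFrame b + (hcpShift + cenShuf c)) 7 * (cenMap c (latPt (1 : E3 →L[ℝ] E3) hexFrame b + (hcpShift + cenShuf c))) a) + deriv (effPot w₄₅ ω₄ (3 / 400)) ‖cenMap c (latPt (1 : E3 →L[ℝ] E3) hexFrame b + (hcpShift + cenShuf c))‖ / ‖cenMap c (latPt (1 : E3 →L[ℝ] E3) hexFrame b + (hcpShift + cenShuf c))‖ * dyR (cenMap c) (latPt (1 : E3 →L[ℝ] E3) hexFrame b + (hcpShift + cenShuf c)) 7 a) + A 2 e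 * ((deriv (deriv (effPot w₄₅ ω₄ (3 / 400))) ‖cenMap c (latPt (1 : E3 →L[ℝ] E3) hexFrame b + (hcpShift + cenShuf c))‖ - deriv (effPot w₄₅ ω₄ (3 / 400)) ‖cenMap c (latPt (1 : E3 →L[ℝ] E3) hexFrame b + (hcpShift + cenShuf c))‖ / ‖cenMap c (latPt (1 : E3 →L[ℝ] E3) hexFrame b + (hcpShift + cenShuf c))‖) / ‖cenMap c (latPt (1 : E3 →L[ℝ] E3) hexFrame b + (hcpShift + cenShuf c))‖ ^ 2 * (zetaN (cenMap c) (latPt (1 : E3 →L[ℝ] E3) hexFrame b + (hcpShift + cenShuf c)) 8 * (cenMap c (latPt (1 : E3 →L[ℝ] E3) hexFrame b + (hcpShift + cenShuf c))) a) + deriv (effPot w₄₅ ω₄ (3 / 400)) ‖cenMap c (latPt (1 : E3 →L[ℝ] E3) hexFrame b + (hcpShift + cenShuf c))‖ / ‖cenMap c (latPt (1 : E3 →L[ℝ] E3) hexFrame b + (hcpShift + cenShuf c))‖ * dyR (cenMap c) (latPt (1 : E3 →L[ℝ] E3) hexFrame b + (hcpShift + cenShuf c)) 8 a))) (jF aP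 Rp a e) := by
  have hJ' : ‖cenMap c (latPt (1 : E3 →L[ℝ] E3) hexFrame b + (hcpShift + cenShuf c))‖ ∉ junctions := by
    rw [map_add, ← latPt_eq_apply_one]; exact hJ
  have hpos0 : 0 < ‖cenMap c (latPt (1 : E3 →L[ℝ] E3) hexFrame b + (hcpShift + cenShuf c))‖ := norm_pos_of_mkDRec hRp _ _ (mem_cenE c) (mem_qB_cen c b)
  obtain ⟨mal, mbe⟩ := mem_coefL hpos0 hJ' (mem_labelQ _ _ (mem_cenE c) (mem_qB_cen c b)) (mkDRec_coefL hRp)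
  have hF : ∀ k, k < 9 → FI.mem ((deriv (deriv (effPot w₄₅ ω₄ (3 / 400))) ‖cenMap c (latPt (1 : E3 →L[ℝ] E3) hexFrame b + (hcpShift + cenShuf c))‖ - deriv (effPot w₄₅ ω₄ (3 / 400)) ‖cenMap c (latPt (1 : E3 →L[ℝ] E3) hexFrame b + (hcpShift + cenShuf c))‖ / ‖cenMap c (latPt (1 : E3 →L[ℝ] E3) hexFrame b + (hcpShift + cenShuf c))‖) / ‖cenMap c (latPt (1 : E3 →L[ℝ] E3) hexFrame b + (hcpShift + cenShuf c))‖ ^ 2 * (zetaN (cenMap c) (latPt (1 : E3 →L[ℝ] E3) hexFrame b + (hcpShift + cenShuf c)) k * (cenMap c (latPt (1 : E3 →L[ℝ] E3) hexFrame b + (hcpShift + cenShuf c))) a) + deriv (effPot w₄₅ ω₄ (3 / 400)) ‖cenMap c (latPt (1 : E3 →L[ℝ] E3) hexFrame b + (hcpShift + cenShuf c))‖ / ‖cenMap c (latPt (1 : E3 →L[ℝ] E3) hexFrame b + (hcpShift + cenShuf c))‖ * dyR (cenMap c) (latPt (1 : E3 →L[ℝ] E3) hexFrame b + (hcpShift +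 cenShuf c)) k a) (dF Rp a k) :=
    fun k hk => mem_dF le_rfl hRp (cenMap c) (latPt (1 : E3 →L[ℝ] E3) hexFrame b + (hcpShift + cenShuf c)) (mem_cenE c) (mem_qB_cen c b) mal mbe a hk
  have hm := mem_jF aP Rp a (fun k => ((deriv (deriv (effPot w₄₅ ω₄ (3 / 400))) ‖cenMap c (latPt (1 : E3 →L[ℝ] E3) hexFrame b + (hcpShift + cenShuf c))‖ - deriv (effPot w₄₅ ω₄ (3 / 400)) ‖cenMap c (latPt (1 : E3 →L[ℝ] E3) hexFrame b + (hcpShift + cenShuf c))‖ / ‖cenMap c (latPt (1 : E3 →L[ℝ] E3) hexFrame b + (hcpShift + cenShuf c))‖) / ‖cenMap c (latPt (1 : E3 →L[ℝ] E3) hexFrame b + (hcpShift + cenShuf c))‖ ^ 2 * (zetaN (cenMap c) (latPt (1 : E3 →L[ℝ] E3) hexFrame b + (hcpShift + cenShuf c)) k * (cenMap c (latPt (1 : E3 →L[ℝ] E3) hexFrame b + (hcpShift + cenShuf c))) a) + deriv (effPot w₄₅ ω₄ (3 / 400)) ‖cenMap c (latPt (1 : E3 →L[ℝ] E3) hexFrame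 b + (hcpShift + cenShuf c))‖ / ‖cenMap c (latPt (1 : E3 →L[ℝ] E3) hexFrame b + (hcpShift + cenShuf c))‖ * dyR (cenMap c) (latPt (1 : E3 →L[ℝ] E3) hexFrame b + (hcpShift + cenShuf c)) k a)) hF he
  rw [hA 0 e (by norm_num) he, hA 1 e (by norm_num) he, hA 2 e (by norm_num) he]
  convert hm using 1
  ring

end Summit.AtomisticToContinuum.Crystallization.Theorems.FrustratedLawDichotomyStrainedPatchHomValueT2Kit
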